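import Mathlib.Topology.Instances.Matrix
import Mathlib.Topology.Algebra.OpenSubgroup
import Literature.NumberTheory.GaloisRepresentations.LiftingObstruction
import Literature.NumberTheory.GaloisRepresentations.ContinuousH2
import Literature.NumberTheory.GaloisRepresentations.GaloisCohomology
import HarnessLib

/-!
# Mazur's obstruction class in continuous cohomology

Topic `Literature/NumberTheory/GaloisRepresentations`.  Continuation of `LiftingObstruction.lean`
(the cochain-level criterion) for a TOPOLOGICAL group `G` and a representation
`ρ : G → GL_n(A)` with open kernel (i.e. continuous for the discrete topology; `A`, `B` are
typically finite), `φ : B ↠ A` a surjection of rings with square-zero kernel `I`, `B` discrete: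

* `adKerRep` — the continuous representation of `G` on the discrete module `M_n(I)` (matrices
  killed by `φ`) by conjugation through `ρ` (`σ · X = s(ρσ) X s(ρσ)⁻¹` for any set-theoretic lift
  `s` of `GL_n(B) ↠ GL_n(A)`); this is `ad ρ ⊗ I`;
* `liftDefectCocycle` — the defect `c(σ, τ) = s(ρσ) s(ρτ) s(ρ(στ))⁻¹ − 1` as a CONTINUOUS
  inhomogeneous `2`-cocycle (tree `contTwoCocycles`), and Mazur's **obstruction class**
  `obstructionClass = [c] ∈ H²_cont(G, M_n(I))` (tree `twoCocycleClass`);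
* `obstructionClass_eq_zero_iff` — **`[c] = 0` iff `ρ` lifts to a homomorphism
  `G → GL_n(B)` with open kernel** (B. Mazur, *Deforming Galois representations* (1989), §1.6,
  proof of Prop. 2: "the obstruction to lifting … lies in `H²(Π, ad ρ̄ ⊗ I)`"; this is the class
  behind Böckle's surjection (1) `H²(Π, ad ρ̄)^* ↠ J/𝔪J`), by the cochain criterion
  `exists_lift_iff_exists_coboundary` and the tree's description of `H²_cont` by continuous
  inhomogeneous cocycles modulo coboundaries of continuous `1`-cochains
  (`twoCocycleClass_eq_zero_iff`, for locally compact `G`): all cochains in sight are locally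
  constant because `ρ` and the lifts have open kernels.

Everything is proved; no named facts.

## References

* B. Mazur, *Deforming Galois representations*, in Galois groups over `ℚ`, MSRI Publ. 16
  (1989), §1.6 (Prop. 2 and its proof). [cite: Mazur1989Deforming, §1.6 Prop. 2]
* G. Böckle, *Presentations of universal deformation rings*, LMS LNS 320 (2007), Thm. 2.2 and
  (1). [cite: Bockle2007Presentations, Theorem 2.2]
-/

noncomputable section

open Topology Filter

namespace Literature.NumberTheory.GaloisRepresentations

namespace LiftingObstruction

universe v

/-- A group homomorphism with open kernel out of a topological group is locally constant (it is
constant on the cosets of its kernel). [folklore] -/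
theorem isLocallyConstant_of_isOpen_ker' {Γ : Type*} [Group Γ] [TopologicalSpace Γ]
    [ContinuousMul Γ] {H : Type*} [Group H] (f : Γ →* H)
    (hf : IsOpen ((f.ker : Subgroup Γ) : Set Γ)) : IsLocallyConstant f := by
  rw [IsLocallyConstant.iff_exists_open]
  intro σ
  refine ⟨{τ | σ⁻¹ * τ ∈ f.ker}, hf.preimage (continuous_const.mul continuous_id), ?_, ?_⟩
  · simp
  · intro τ hτ
    simp only [Set.mem_setOf_eq, MonoidHom.mem_ker, map_mul, map_inv, inv_mul_eq_one] at hτ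
    exact hτ.symm

variable {n : Type} [Fintype n] [DecidableEq n] {A B : Type v} [CommRing A] [CommRing B]
  [TopologicalSpace B] [DiscreteTopology B] {φ : B →+* A}
  (hI : ∀ x ∈ RingHom.ker φ, ∀ y ∈ RingHom.ker φ, x * y = 0)
  {s : GL n A → GL n B} (hs : ∀ g, Matrix.GeneralLinearGroup.map φ (s g) = g)
  {G : Type v} [Group G] [TopologicalSpace G] [IsTopologicalGroup G]
  (ρ : G →* GL n A) (hρ : IsOpen ((ρ.ker : Subgroup G) : Set G))

include hI hs hρ

/-! ## 1. The coefficients `M_n(I) = ad ρ ⊗ I` -/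

omit [TopologicalSpace B] [DiscreteTopology B] [TopologicalSpace G] [IsTopologicalGroup G] hI hs hρ in
/-- Conjugation by `s(ρσ)` on `M_n(I)`, as an additive endomorphism. [cite: Mazur1989Deforming, §1.6 Prop. 2] -/
def conjKer (σ : G) : kerMatrix (n := n) φ →+ kerMatrix (n := n) φ where
  toFun X := ⟨(s (ρ σ) : Matrix n n B) * (X : Matrix n n B) * ((s (ρ σ))⁻¹ : GL n B),
    mul_mem_kerMatrix_right _ (mul_mem_kerMatrix_left _ X.2)⟩
  map_zero' := Subtype.ext (by simp)
  map_add' X Y := Subtype.ext (by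
    change (s (ρ σ) : Matrix n n B) * ((X : Matrix n n B) + Y) * ((s (ρ σ))⁻¹ : GL n B) =
      (s (ρ σ) : Matrix n n B) * (X : Matrix n n B) * ((s (ρ σ))⁻¹ : GL n B) +
        (s (ρ σ) : Matrix n n B) * (Y : Matrix n n B) * ((s (ρ σ))⁻¹ : GL n B)
    rw [mul_add, add_mul])

omit [TopologicalSpace B] [DiscreteTopology B] [TopologicalSpace G] [IsTopologicalGroup G] hI hs hρ in
/-- Unfolding `conjKer`. [folklore] -/
@[simp] theorem coe_conjKer_apply (σ : G) (X : kerMatrix (n := n) φ) :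
    ((conjKer (s := s) ρ σ X : kerMatrix (n := n) φ) : Matrix n n B) =
      (s (ρ σ) : Matrix n n B) * (X : Matrix n n B) * ((s (ρ σ))⁻¹ : GL n B) :=
  rfl

omit [TopologicalSpace B] [DiscreteTopology B] [TopologicalSpace G] [IsTopologicalGroup G] hρ in
/-- The conjugation action of `G` on `M_n(I)` through `ρ` is a representation: it does not
depend on the chosen lifts (`conj_eq_of_map_eq`), and `s(ρ1)`, a lift of `1`, acts trivially.
[cite: Mazur1989Deforming, §1.6 Prop. 2] -/
def adKerRepresentation : Representation ℤ G (kerMatrix (n := n) φ) where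
  toFun σ := (conjKer (s := s) ρ σ).toIntLinearMap
  map_one' := by
    refine LinearMap.ext fun X => Subtype.ext ?_
    change (s (ρ 1) : Matrix n n B) * (X : Matrix n n B) * ((s (ρ 1))⁻¹ : GL n B) = (X : Matrix n n B)
    rw [map_one]
    exact conj_eq_self_of_map_eq_one hI (s 1) (hs 1) X.2
  map_mul' σ τ := by
    refine LinearMap.ext fun X => Subtype.ext ?_
    change (s (ρ (σ * τ)) : Matrix n n B) * (X : Matrix n n B) * ((s (ρ (σ * τ)))⁻¹ : GL n B) =
      (s (ρ σ) : Matrix n n B) * ((s (ρ τ) : Matrix n n B) * (X : Matrix n n B) *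
        ((s (ρ τ))⁻¹ : GL n B)) * ((s (ρ σ))⁻¹ : GL n B)
    have h := conj_eq_of_map_eq hI (s (ρ (σ * τ))) (s (ρ σ) * s (ρ τ))
      (by rw [hs, map_mul ρ, _root_.map_mul (Matrix.GeneralLinearGroup.map φ) (s (ρ σ)), hs, hs])
      X.2
    rw [h, _root_.mul_inv_rev, Units.val_mul, Units.val_mul]
    noncomm_ring

/-- **`ad ρ ⊗ I` as a continuous representation** on the discrete module `M_n(I)`: the
stabilisers contain the open kernel of `ρ`. [cite: Mazur1989Deforming, §1.6 Prop. 2] -/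
def adKerRep : ContinuousRep G ℤ (kerMatrix (n := n) φ) :=
  ContinuousRep.ofStabilizerMemNhdsOne (adKerRepresentation hI hs ρ) fun X => by
    refine Filter.mem_of_superset (hρ.mem_nhds (by simp)) fun σ hσ => ?_
    rw [SetLike.mem_coe, MonoidHom.mem_ker] at hσ
    refine Subtype.ext ?_
    change (s (ρ σ) : Matrix n n B) * (X : Matrix n n B) * ((s (ρ σ))⁻¹ : GL n B) = (X : Matrix n n B)
    rw [hσ]
    exact conj_eq_self_of_map_eq_one hI (s 1) (hs 1) X.2

/-- Unfolding the action of `adKerRep`. [folklore] -/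
@[simp] theorem coe_adKerRep_apply (σ : G) (X : kerMatrix (n := n) φ) :
    ((adKerRep hI hs ρ hρ σ X : kerMatrix (n := n) φ) : Matrix n n B) =
      (s (ρ σ) : Matrix n n B) * (X : Matrix n n B) * ((s (ρ σ))⁻¹ : GL n B) :=
  rfl

/-- Unfolding the action of the `TopRep` of `adKerRep`. [folklore] -/
@[simp] theorem toTopRep_ρ_adKerRep_apply (σ : G) (X : kerMatrix (n := n) φ) :
    (((adKerRep hI hs ρ hρ).toTopRep.ρ σ X : kerMatrix (n := n) φ) : Matrix n n B) =
      (s (ρ σ) : Matrix n n B) * (X : Matrix n n B) * ((s (ρ σ))⁻¹ : GL n B) :=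
  rfl

/-! ## 2. The defect as a continuous `2`-cocycle and the obstruction class -/

omit [TopologicalSpace B] [DiscreteTopology B] hI hs in
/-- The defect `(σ, τ) ↦ c(σ, τ)` is locally constant (it factors through `(ρσ, ρτ)`). [folklore] -/
theorem isLocallyConstant_liftDefect :
    IsLocallyConstant fun p : G × G => liftDefect s ρ p.1 p.2 := by
  have hρlc := isLocallyConstant_of_isOpen_ker' ρ hρ
  have h1 : IsLocallyConstant fun p : G × G => (ρ p.1, ρ p.2) :=
    (hρlc.comp_continuous continuous_fst).prodMk (hρlc.comp_continuous continuous_snd)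
  have h2 := h1.comp fun q : GL n A × GL n A =>
    ((s q.1 * s q.2 * (s (q.1 * q.2))⁻¹ : GL n B) : Matrix n n B) - 1
  convert h2 using 1
  funext p
  simp only [Function.comp_apply, liftDefect, defectUnit, map_mul]

/-- **Mazur's obstruction cocycle**: the defect `c(σ, τ) = s(ρσ) s(ρτ) s(ρ(στ))⁻¹ − 1` as a
continuous inhomogeneous `2`-cocycle of `G` with values in `M_n(I) = ad ρ ⊗ I`.
[cite: Mazur1989Deforming, §1.6 Prop. 2] -/
def liftDefectCocycle : contTwoCocycles (adKerRep hI hs ρ hρ).toTopRep :=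
  ⟨⟨fun p => ⟨liftDefect s ρ p.1 p.2, liftDefect_mem hs ρ p.1 p.2⟩,
    (IsLocallyConstant.desc _ Subtype.val (isLocallyConstant_liftDefect ρ hρ)
      Subtype.val_injective).continuous⟩,
    fun σ τ υ => Subtype.ext (by
      change (s (ρ σ) : Matrix n n B) * liftDefect s ρ τ υ * ((s (ρ σ))⁻¹ : GL n B) +
          liftDefect s ρ σ (τ * υ) =
        liftDefect s ρ (σ * τ) υ + liftDefect s ρ σ τ
      exact liftDefect_cocycle hs hI ρ σ τ υ)⟩

/-- Unfolding `liftDefectCocycle`. [folklore] -/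
@[simp] theorem coe_liftDefectCocycle_apply (σ τ : G) :
    (((liftDefectCocycle hI hs ρ hρ).1 (σ, τ) : kerMatrix (n := n) φ) : Matrix n n B) =
      liftDefect s ρ σ τ :=
  rfl

variable [LocallyCompactSpace G]

/-- **Mazur's obstruction class** `o(ρ) ∈ H²_cont(G, ad ρ ⊗ I)`. [cite: Mazur1989Deforming, §1.6 Prop. 2] -/
def obstructionClass : continuousCohomology 2 (adKerRep hI hs ρ hρ).toTopRep :=
  twoCocycleClass _ (liftDefectCocycle hI hs ρ hρ)

/-- **Mazur's obstruction criterion, continuous form.**  For a topological group `G` (locally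
compact), `ρ : G → GL_n(A)` with open kernel and `φ : B ↠ A` with square-zero kernel (`B`
discrete): the class `o(ρ) ∈ H²_cont(G, ad ρ ⊗ I)` vanishes iff `ρ` lifts to a homomorphism
`ρ̃ : G → GL_n(B)` with open kernel (`φ ∘ ρ̃ = ρ`).  Proof: `o(ρ) = 0` iff the defect is the
coboundary of a CONTINUOUS `1`-cochain `b` (`twoCocycleClass_eq_zero_iff`); then
`σ ↦ (1 − b(σ)) s(ρσ)` is a lift (`liftOfCoboundary`), with open kernel because `b` is locally
constant and `ρ` has open kernel; conversely the splitting cochain of a lift with open kernel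
(`liftDefect_eq_of_lift`) is locally constant, hence continuous.
[cite: Mazur1989Deforming, §1.6 Prop. 2] [cite: Bockle2007Presentations, Theorem 2.2] -/
theorem obstructionClass_eq_zero_iff :
    obstructionClass hI hs ρ hρ = 0 ↔
      ∃ ρ' : G →* GL n B, IsOpen ((ρ'.ker : Subgroup G) : Set G) ∧
        ∀ σ, Matrix.GeneralLinearGroup.map φ (ρ' σ) = ρ σ := by
  unfold obstructionClass
  rw [twoCocycleClass_eq_zero_iff]
  constructor
  · rintro ⟨b, hb⟩
    have hb' : ∀ σ τ, liftDefect s ρ σ τ =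
        (s (ρ σ) : Matrix n n B) * (b τ : Matrix n n B) * ((s (ρ σ))⁻¹ : GL n B) -
          (b (σ * τ) : Matrix n n B) + (b σ : Matrix n n B) := fun σ τ => by
      exact congrArg (fun X : kerMatrix (n := n) φ => (X : Matrix n n B)) (hb σ τ)
    refine ⟨liftOfCoboundary hs hI ρ (fun σ => (b σ : Matrix n n B)) (fun σ => (b σ).2) hb', ?_,
      map_liftOfCoboundary hs hI ρ _ _ hb'⟩
    -- open kernel: it contains `ker ρ ∩ {b = b 1}`, a neighbourhood of `1`
    refine Subgroup.isOpen_of_mem_nhds _ (g := 1) ?_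
    have hU : ({σ : G | ρ σ = 1} ∩ {σ | b σ = b 1}) ∈ 𝓝 (1 : G) := by
      refine Filter.inter_mem (hρ.mem_nhds (by simp)) ?_
      exact ((isOpen_discrete {b 1}).preimage b.continuous).mem_nhds rfl
    refine Filter.mem_of_superset hU ?_
    rintro σ ⟨hσ1, hσ2⟩
    rw [Set.mem_setOf_eq] at hσ1 hσ2
    have key : liftOfCoboundary hs hI ρ _ (fun σ => (b σ).2) hb' σ =
        liftOfCoboundary hs hI ρ _ (fun σ => (b σ).2) hb' 1 := by
      rw [liftOfCoboundary_apply, liftOfCoboundary_apply]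
      have e1 : unitOfKer hI (-(b σ : Matrix n n B)) (neg_mem (b σ).2) =
          unitOfKer hI (-(b 1 : Matrix n n B)) (neg_mem (b 1).2) :=
        Units.ext (by simp [hσ2])
      rw [e1, hσ1, ρ.map_one]
    rw [SetLike.mem_coe, MonoidHom.mem_ker, key, MonoidHom.map_one]
  · rintro ⟨ρ', hρ'open, hρ'⟩
    obtain ⟨hbmem, hcob⟩ := liftDefect_eq_of_lift hs hI ρ ρ' hρ'
    have hlc : IsLocallyConstant fun σ : G =>
        -(((ρ' σ * (s (ρ σ))⁻¹ : GL n B) : Matrix n n B) - 1) := by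
      have h1 : IsLocallyConstant fun σ : G => (ρ' σ, ρ σ) :=
        (isLocallyConstant_of_isOpen_ker' ρ' hρ'open).prodMk (isLocallyConstant_of_isOpen_ker' ρ hρ)
      exact h1.comp fun q : GL n B × GL n A => -(((q.1 * (s q.2)⁻¹ : GL n B) : Matrix n n B) - 1)
    refine ⟨⟨fun σ => ⟨-(((ρ' σ * (s (ρ σ))⁻¹ : GL n B) : Matrix n n B) - 1), hbmem σ⟩,
      (IsLocallyConstant.desc _ Subtype.val hlc Subtype.val_injective).continuous⟩,
      fun σ τ => Subtype.ext ?_⟩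
    exact hcob σ τ

end LiftingObstruction

end Literature.NumberTheory.GaloisRepresentations
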